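import Summits.HodgeConjecture.HodgeConjecture.Theorems.CyclicUnitaryPowersGenericPencilsHodgeOffCountable
import Literature.AlgebraicGeometry.FundamentalGroup.HypersurfaceComplementPencilDiscriminantFixedBaseSquarefree
import HarnessLib

/-!
# Route CyclicUnitaryPowers — EVERY smooth `p`-cyclic surface `x₃^p = f₀` lies on a good pencil: for some direction
# `g` (in fact all `g` off a proper algebraic subset), all but countably many members of `x₃^p = f₀ + u·g` have the
# Hodge conjecture on all their powers (reading (a″) through every smooth member; unconditional)

Support file for `stmt-HodgeConjecture-19544` (`--supports`; nothing here closes an item).  Prover seat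
`hodge-nonav-prover-Ax` (g15), programme «FIXED-BASE BERTINI»: the pencil leaf
`CyclicUnitaryPowersGenericPencilsHodgeOffCountable.hodgeConjectureFor_powers_offCountable_of_pencil` (g14) asks for a
pointed line `(f₀, g)` with `pencilDiscr D (f₀, g) ≠ 0` (`D` the irreducible discriminant equation); the fixed-base
Bertini theorem `exists_eval_pencilDiscr_ne_zero_of_squarefree` (Dimca Ch. 4 Prop. (3.1), pointed form; `D` irreducible
⇒ squarefree) supplies such a `g` through EVERY base point `f₀` with `x₃^p − f₀` nonsingular.  So the good pencils COVER
the smooth locus: every smooth `p`-cyclic surface is the member `u = 0` of a one-parameter algebraic family along which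
all but countably many members satisfy HC on all self-powers (it may itself be one of the countably many exceptions —
this is NOT reading (b); items 19544 ∕ 19543 stay OPEN; rung F-H1 not moved; HC ∕ HC_CM ∕ HC_AV not proved).

## References
* [Dimca1992] A. Dimca, *Singularities and Topology of Hypersurfaces* (1992), Ch. 4 §3 Prop. (3.1).
* [CarlsonToledo1999] J. A. Carlson, D. Toledo, Duke Math. J. 97 (1999), §7 Theorem 7.1.
* [VoisinHodgeII2003] C. Voisin, *Hodge Theory and Complex Algebraic Geometry II*, §3.2.2 Thm. 3.22 and §6.2.1.
-/

noncomputable section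

set_option linter.dupNamespace false

namespace Summit.HodgeConjecture.HodgeConjecture.Theorems.CyclicUnitaryPowersGenericCyclicSurfacePowersHodge

open CategoryTheory CategoryTheory.Limits
open Literature.AlgebraicGeometry.Motives Literature.AlgebraicGeometry.HodgeTheory
open Literature.AlgebraicGeometry.Motives.UniversalHypersurface Literature.AlgebraicGeometry.HodgeTheory.UniversalHypersurface
open Literature.AlgebraicGeometry.FundamentalGroup
open Literature.AlgebraicGeometry.Motives.SmoothHypersurface (IsNonsingularForm)

/-- **Every smooth `p`-cyclic surface lies on a good pencil** (`p ≥ 7` prime): if `x₃^p − f₀` is nonsingular there is a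
direction `g` and a COUNTABLE `C ⊆ ℂ` such that for every `u ∉ C`, every smooth projective `X ⊂ ℙ³` cut out by
`x₃^p − Σ_e ((f₀)_e + u g_e) x^e` and every self fibre power `Y = X^{k+1}` satisfy `HodgeConjectureFor (2(k+1)) Y`.
Unconditional. [cite: Dimca1992, Ch. 4 §3 Prop. (3.1)] [cite: CarlsonToledo1999, §7 Theorem 7.1]
[cite: VoisinHodgeII2003, §3.2.2 Thm. 3.22 and §6.2.1] -/
theorem exists_goodPencil_through {p : ℕ} (hp : p.Prime) (h7 : 7 ≤ p) {f₀ : TernaryIndex p → ℂ}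
    (hf₀ : IsNonsingularForm ℂ (cyclicCoverForm p (∑ e : TernaryIndex p, MvPolynomial.monomial e.1 (f₀ e)))) :
    ∃ g : TernaryIndex p → ℂ, ∃ C : Set ℂ, C.Countable ∧ ∀ u : ℂ, u ∉ C →
      ∀ ⦃X : SchemeOver ℂ⦄, IsSmoothProjective 2 X →
        IsHypersurfaceCutOutBy 3 (MvPolynomial.X (Fin.last 3) ^ p - MvPolynomial.rename Fin.castSucc
          (∑ e : TernaryIndex p, MvPolynomial.monomial e.1 (f₀ e + u * g e))) X →
        ∀ ⦃k : ℕ⦄ ⦃Y : SchemeOver ℂ⦄, (∃ π : Fin (k + 1) → (Y ⟶ X), Nonempty (IsLimit (Fan.mk Y π))) →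
          HodgeConjectureFor (2 * (k + 1)) Y := by
  classical
  obtain ⟨D, hDirr, hD⟩ := exists_irreducible_discriminantEquation (p := p) (by omega)
  have hb : MvPolynomial.eval f₀ D ≠ 0 := fun h0 => (hD f₀).1 h0 hf₀
  obtain ⟨g, hQ⟩ := exists_eval_pencilDiscr_ne_zero_of_squarefree hDirr.squarefree hb
  exact ⟨g, hodgeConjectureFor_powers_offCountable_of_pencil hp h7 hDirr hD hQ⟩

/-- The same for a homogeneous ternary form `f₀` of degree `p` with `x₃^p − f₀` nonsingular: a direction FORM `g` and the
members `x₃^p = f₀ + u·g`. [cite: Dimca1992, Ch. 4 §3 Prop. (3.1)] [cite: CarlsonToledo1999, §7 Theorem 7.1] -/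
theorem exists_goodPencil_through_form {p : ℕ} (hp : p.Prime) (h7 : 7 ≤ p) {f₀ : MvPolynomial (Fin 3) ℂ}
    (hf₀ : f₀.IsHomogeneous p) (hJ : IsNonsingularForm ℂ (cyclicCoverForm p f₀)) :
    ∃ g : MvPolynomial (Fin 3) ℂ, g.IsHomogeneous p ∧ ∃ C : Set ℂ, C.Countable ∧ ∀ u : ℂ, u ∉ C →
      ∀ ⦃X : SchemeOver ℂ⦄, IsSmoothProjective 2 X →
        IsHypersurfaceCutOutBy 3 (MvPolynomial.X (Fin.last 3) ^ p -
          MvPolynomial.rename Fin.castSucc (f₀ + MvPolynomial.C u * g)) X →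
        ∀ ⦃k : ℕ⦄ ⦃Y : SchemeOver ℂ⦄, (∃ π : Fin (k + 1) → (Y ⟶ X), Nonempty (IsLimit (Fan.mk Y π))) →
          HodgeConjectureFor (2 * (k + 1)) Y := by
  classical
  have hf₀eq : (∑ e : TernaryIndex p, MvPolynomial.monomial e.1 (f₀.coeff e.1)) = f₀ := formOfCoeffs_coeff (n := 1) (d := p) f₀ hf₀
  have hJ' : IsNonsingularForm ℂ (cyclicCoverForm p (∑ e : TernaryIndex p, MvPolynomial.monomial e.1 (f₀.coeff e.1))) := by
    rw [hf₀eq]; exact hJ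
  obtain ⟨g, C, hCc, hC⟩ := exists_goodPencil_through hp h7 hJ'
  refine ⟨∑ e : TernaryIndex p, MvPolynomial.monomial e.1 (g e), isHomogeneous_sum_monomial p g, C, hCc,
    fun u hu X hX hcut k Y hY => hC u hu hX ?_ hY⟩
  have heq : (∑ e : TernaryIndex p, MvPolynomial.monomial e.1 (f₀.coeff e.1 + u * g e)) =
      f₀ + MvPolynomial.C u * ∑ e : TernaryIndex p, MvPolynomial.monomial e.1 (g e) := by
    conv_rhs => rw [← hf₀eq]
    rw [Finset.mul_sum, ← Finset.sum_add_distrib]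
    refine Finset.sum_congr rfl fun e _ => ?_
    rw [MvPolynomial.C_mul_monomial, ← map_add]
  rw [heq]
  exact hcut

end Summit.HodgeConjecture.HodgeConjecture.Theorems.CyclicUnitaryPowersGenericCyclicSurfacePowersHodge

end
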